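import Summits.Ventures.CertifiedManyBodySolver.Downfold.EmeryFermiSurfaceHarmonics
import Summits.Ventures.CertifiedManyBodySolver.Downfold.EmeryAxialFermiSurfaceShape
import HarnessLib

/-!
# THE AXIAL CHANNEL CREATES NO FERMI-SURFACE HARMONIC: in the four-orbital (d, s, pₓ, p_y) model extended by
# `t_pp`, `t_pp′`, the same-sublattice `t_pp″` and the direct `t_dd`, eliminating the Cu-4s orbital co-shifts
# `(t_pp, t_pp′)` ONLY — `t_pp″` and `t_dd` are untouched, so the harmonic content of §B.99 is axial-invariant

Venture CertifiedManyBodySolver, cell `pub/hubbard-downfold` (stage S1), seat hubbard-downfold-mod-4 (technique B,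
g44; INFL-3to1-B §B.99 (d)); namespace `Summit.Ventures.CertifiedManyBodySolver.Downfold.Emery`. All PROVED (exact
algebra). Completes the HARMONIC CENSUS of the standard one-body extensions of the σ quartet at the Fermi surface:
`EmeryFermiSurfaceShape` (§B.13: `t_pp`, `t_pp′` ⇒ exact `t–t′`), `EmeryAxialFermiSurfaceShape` (§B.63: + Cu-4s ⇒
still exact `t–t′`, the axial channel = ONE co-shift `a(ε) = t_sp²/(ε_s − ε)` of both O–O hoppings),
`EmeryFermiSurfaceHarmonics` (§B.99: + `t_pp″` ⇒ exact `t″`; + `t_dd` ⇒ exact `t″`, `t‴`). HERE: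
* §1 `fourBand6` — the (d, s, pₓ, p_y) Bloch matrix of `fourBandPP` with `t_pp″ = c₂` (`−4c₂sy²` on `p_x`,
  `−4c₂sx²` on `p_y`) and `t_dd = d` (`4d(1 − sx² − sy²)` on `d`); `det_fourBand6_sub`:
  `det(H₄ − ε) = −[(ε_s − ε)·charPoly6 + t_sp²·axialLin6]` in closed form, where `axialLin6` is the CO-SHIFT
  coefficient `charPoly6(t_pp + a, t_pp′ + a) = charPoly6 + a·axialLin6` (`charPoly6_coshift`: the extended secular
  polynomial is still AFFINE in a common shift of `t_pp`, `t_pp′`; `axialLin6 = axialLin` at `c₂ = d = 0`).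
* §2 `det_fourBand6_sub_eq_coshift` / `det_fourBand6_eq_zero_iff_charPoly6` (`ε ≠ ε_s`): the four-orbital secular
  equation IS the σ + `t_pp″` + `t_dd` secular equation at the co-shifted point `(t_pp + a, t_pp′ + a)` with the SAME
  `t_pp″` and `t_dd` — Löwdin elimination of the a₁g-coupled s orbital renormalises the `b₁g`-channel O–O hoppings and
  nothing else.
* §3 CONSEQUENCES: (i) `det_fourBand6_tdd_zero_eq_zero_iff_oneBand` — every constant-energy contour of the
  four-orbital + `t_pp″` model (`d = 0`, `ε ≠ ε_s`) is EXACTLY a `t–t′–t″` contour with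
  `t″/t′ = fsM5(t_pp′ + a)/fsN5(t_pp + a, t_pp′ + a)` (`fsM5_coshift`: `= c₂(t_pd² − (t_pp′ + a)ε)`); (ii) with
  `c₂ = 0` there is NO `t″` at ANY axial admixture (`fsM5_coshift_zero`) — the Cu-4s / apical channel, however
  strong, cannot generate a Fermi-surface harmonic beyond `t′`; the ONLY one-body sources of exact higher harmonics
  among {`t_pp`, `t_pp′`, Cu-4s, `t_pp″`, `t_dd`} are the last two; (iii) `ddT3_coshift`: `ddT3(t_pp + a, t_pp′ + a) = d(t_pp − t_pp′)(t_pp + t_pp′ + 2a)` — the axial channel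
  RESCALES the `t‴` that `t_dd` generates (factor `(t_pp + t_pp′ + 2a)/(t_pp + t_pp′)`) but cannot create it
  without `t_dd`.

WHAT THIS IS NOT: statements about materials; the axial level `ε_s` and coupling `t_sp` are model inputs; only
ratios/contours are physical; `U = 0` one-body kinematics. Sources: [AndersenEtAl1995, §§5–6];
[PavariniEtAl2001, Eqs. (1)–(3)]; [HybertsenSchluterChristensen1989, Eq. (1)].
-/

noncomputable section

namespace Summit.Ventures.CertifiedManyBodySolver.Downfold.Emery

open Real

/-! ## §1 The four-orbital matrix with `t_pp″`, `t_dd` and its determinant -/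

/-- The (d, s, pₓ, p_y) Bloch matrix `fourBandPP` (`ε_d = 0`, axial level `ε_s`, `ε_p = −Δ`; `t_pd`, `t_sp`,
`t_pp`, `t_pp′ = c`) extended by the same-sublattice oxygen hopping `t_pp″ = c₂` and the direct Cu–Cu hopping
`t_dd = d` (conventions of `bloch6`). [cite: AndersenEtAl1995, Eq. (1)]; [cite: PavariniEtAl2001, Eqs. (1)–(3)] -/
def fourBand6 (Δ εs tpd tpp c c₂ d tsp sx sy : ℝ) : Matrix (Fin 4) (Fin 4) ℝ :=
  !![4 * d * (1 - sx ^ 2 - sy ^ 2), 0, 2 * tpd * sx, -2 * tpd * sy;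
     0, εs, 2 * tsp * sx, 2 * tsp * sy;
     2 * tpd * sx, 2 * tsp * sx, -Δ - 4 * c * sx ^ 2 - 4 * c₂ * sy ^ 2, -4 * tpp * sx * sy;
     -2 * tpd * sy, 2 * tsp * sy, -4 * tpp * sx * sy, -Δ - 4 * c * sy ^ 2 - 4 * c₂ * sx ^ 2]

/-- With `c₂ = d = 0` this is `fourBandPP`. [folklore] -/
theorem fourBand6_zero_zero (Δ εs tpd tpp c tsp sx sy : ℝ) :
    fourBand6 Δ εs tpd tpp c 0 0 tsp sx sy = fourBandPP Δ εs tpd tpp c tsp sx sy := by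
  ext i j
  fin_cases i <;> fin_cases j <;> simp [fourBand6, fourBandPP]

/-- The CO-SHIFT coefficient of the extended secular polynomial:
`axialLin6 = (ε − 4d(1 − x − y))·(4(Δ + ε)(x + y) + 32(c − t_pp)xy + 16c₂(x² + y²)) − 64t_pd²·xy`
(`= axialLin` at `c₂ = d = 0`). [folklore] -/
def axialLin6 (Δ tpd tpp c c₂ d x y ε : ℝ) : ℝ :=
  (ε - 4 * d * (1 - x - y)) * (4 * (Δ + ε) * (x + y) + 32 * (c - tpp) * (x * y) + 16 * c₂ * (x ^ 2 + y ^ 2))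
    - 64 * tpd ^ 2 * (x * y)

/-- `axialLin6 = axialLin` at `c₂ = d = 0`. [folklore] -/
theorem axialLin6_zero_zero (Δ tpd tpp c x y ε : ℝ) :
    axialLin6 Δ tpd tpp c 0 0 x y ε = axialLin Δ tpd tpp c x y ε := by
  unfold axialLin6 axialLin
  ring

/-- THE EXTENDED SECULAR POLYNOMIAL IS AFFINE IN A COMMON O–O SHIFT:
`charPoly6(t_pp + a, t_pp′ + a) = charPoly6(t_pp, t_pp′) + a·axialLin6` (the `a²` terms cancel; `t_pp″`, `t_dd`
ride along unchanged). [folklore] -/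
theorem charPoly6_coshift (Δ tpd tpp c c₂ d a x y ε : ℝ) :
    charPoly6 Δ tpd (tpp + a) (c + a) c₂ d x y ε =
      charPoly6 Δ tpd tpp c c₂ d x y ε + a * axialLin6 Δ tpd tpp c c₂ d x y ε := by
  unfold charPoly6 axialLin6
  ring

/-- `fourBand6 − ε·1` written out. [folklore] -/
def secular6 (Δ εs tpd tpp c c₂ d tsp sx sy ε : ℝ) : Matrix (Fin 4) (Fin 4) ℝ :=
  !![4 * d * (1 - sx ^ 2 - sy ^ 2) - ε, 0, 2 * tpd * sx, -2 * tpd * sy;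
     0, εs - ε, 2 * tsp * sx, 2 * tsp * sy;
     2 * tpd * sx, 2 * tsp * sx, -Δ - 4 * c * sx ^ 2 - 4 * c₂ * sy ^ 2 - ε, -4 * tpp * sx * sy;
     -2 * tpd * sy, 2 * tsp * sy, -4 * tpp * sx * sy, -Δ - 4 * c * sy ^ 2 - 4 * c₂ * sx ^ 2 - ε]

/-- `fourBand6 − ε·1 = secular6`. [folklore] -/
theorem fourBand6_sub_smul (Δ εs tpd tpp c c₂ d tsp sx sy ε : ℝ) :
    fourBand6 Δ εs tpd tpp c c₂ d tsp sx sy - ε • (1 : Matrix (Fin 4) (Fin 4) ℝ) =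
      secular6 Δ εs tpd tpp c c₂ d tsp sx sy ε := by
  ext i j
  fin_cases i <;> fin_cases j <;> simp [fourBand6, secular6]

/-- THE FOUR-ORBITAL + `t_pp″` + `t_dd` DETERMINANT IN CLOSED FORM (all k, all ε):
`det(H₄ − ε) = −[(ε_s − ε)·charPoly6(sx², sy², ε) + t_sp²·axialLin6(sx², sy², ε)]`.
[cite: AndersenEtAl1995, Eqs. (2), (5)] -/
theorem det_fourBand6_sub (Δ εs tpd tpp c c₂ d tsp sx sy ε : ℝ) :
    (fourBand6 Δ εs tpd tpp c c₂ d tsp sx sy - ε • (1 : Matrix (Fin 4) (Fin 4) ℝ)).det =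
      -((εs - ε) * charPoly6 Δ tpd tpp c c₂ d (sx ^ 2) (sy ^ 2) ε
        + tsp ^ 2 * axialLin6 Δ tpd tpp c c₂ d (sx ^ 2) (sy ^ 2) ε) := by
  rw [fourBand6_sub_smul]
  simp [secular6, Matrix.det_succ_row_zero, Fin.sum_univ_succ, Fin.succAbove, charPoly6, axialLin6]
  ring

/-! ## §2 Löwdin elimination of the axial orbital: the co-shifted extended σ model -/

/-- For `ε ≠ ε_s`: `det(H₄ − ε) = −(ε_s − ε)·charPoly6(t_pp + a, t_pp′ + a; t_pp″, t_dd)` with the axial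
admixture `a = t_sp²/(ε_s − ε)` — eliminating the s orbital co-shifts `t_pp` and `t_pp′` and leaves `t_pp″`, `t_dd`
unchanged. [cite: PavariniEtAl2001, Eqs. (1)–(3)] -/
theorem det_fourBand6_sub_eq_coshift (Δ εs tpd tpp c c₂ d tsp sx sy ε : ℝ) (hε : ε ≠ εs) :
    (fourBand6 Δ εs tpd tpp c c₂ d tsp sx sy - ε • (1 : Matrix (Fin 4) (Fin 4) ℝ)).det =
      -((εs - ε) * charPoly6 Δ tpd (tpp + tsp ^ 2 / (εs - ε)) (c + tsp ^ 2 / (εs - ε)) c₂ d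
        (sx ^ 2) (sy ^ 2) ε) := by
  have hne : εs - ε ≠ 0 := sub_ne_zero.mpr (Ne.symm hε)
  rw [det_fourBand6_sub, charPoly6_coshift]
  field_simp

/-- THE FOUR-ORBITAL + `t_pp″` + `t_dd` SECULAR EQUATION IS THE CO-SHIFTED EXTENDED σ SECULAR EQUATION
(`ε ≠ ε_s`). [cite: PavariniEtAl2001, Eqs. (1)–(3)] -/
theorem det_fourBand6_eq_zero_iff_charPoly6 (Δ εs tpd tpp c c₂ d tsp sx sy ε : ℝ) (hε : ε ≠ εs) :
    (fourBand6 Δ εs tpd tpp c c₂ d tsp sx sy - ε • (1 : Matrix (Fin 4) (Fin 4) ℝ)).det = 0 ↔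
      charPoly6 Δ tpd (tpp + tsp ^ 2 / (εs - ε)) (c + tsp ^ 2 / (εs - ε)) c₂ d (sx ^ 2) (sy ^ 2) ε = 0 := by
  have hne : εs - ε ≠ 0 := sub_ne_zero.mpr (Ne.symm hε)
  rw [det_fourBand6_sub_eq_coshift Δ εs tpd tpp c c₂ d tsp sx sy ε hε, neg_eq_zero, mul_eq_zero]
  constructor
  · rintro (h | h)
    · exact absurd h hne
    · exact h
  · intro h
    exact Or.inr h

/-! ## §3 Consequences: the harmonic content is axial-invariant -/

/-- The `t″` weight at the co-shifted point: `fsM5(t_pp′ + a) = c₂(t_pd² − (t_pp′ + a)ε)` — proportional to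
`c₂` at every axial admixture. [folklore] -/
theorem fsM5_coshift (tpd c c₂ a ε : ℝ) :
    fsM5 tpd (c + a) c₂ ε = c₂ * (tpd ^ 2 - (c + a) * ε) := rfl

/-- NO `t″` WITHOUT `t_pp″`, AT ANY AXIAL ADMIXTURE: `fsM5(t_pp′ + a; c₂ = 0) = 0` — the Cu-4s / apical channel
cannot generate a Fermi-surface harmonic beyond `t′`. [folklore] -/
theorem fsM5_coshift_zero (tpd c a ε : ℝ) : fsM5 tpd (c + a) 0 ε = 0 := fsM5_zero tpd (c + a) ε

/-- THE CONTOUR THEOREM FOR THE FOUR-ORBITAL + `t_pp″` MODEL (`d = 0`, `ε ≠ ε_s`): `ε` is a band energy at `k`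
iff `k` lies on the `t–t′–t″` contour of `EmeryFermiSurfaceHarmonics` §3 taken at the co-shifted O–O hoppings
`(t_pp + a, t_pp′ + a)`, `a = t_sp²/(ε_s − ε)`, with the SAME `t_pp″`: exact `t″/t′ =
fsM5(t_pp′ + a)/fsN5(t_pp + a, t_pp′ + a)`. [cite: AndersenEtAl1995, §6]; [cite: PavariniEtAl2001, Eqs. (1)–(3)] -/
theorem det_fourBand6_tdd_zero_eq_zero_iff_oneBand (Δ εs tpd tpp c c₂ tsp kx ky ε γ : ℝ) (hε : ε ≠ εs) :
    (fourBand6 Δ εs tpd tpp c c₂ 0 tsp (Real.sin (kx / 2)) (Real.sin (ky / 2))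
        - ε • (1 : Matrix (Fin 4) (Fin 4) ℝ)).det = 0 ↔
      oneBand γ (fsT5 Δ tpd (tpp + tsp ^ 2 / (εs - ε)) (c + tsp ^ 2 / (εs - ε)) c₂ ε)
          (fsTp5 tpd (tpp + tsp ^ 2 / (εs - ε)) (c + tsp ^ 2 / (εs - ε)) c₂ ε)
          (fsTpp5 tpd (c + tsp ^ 2 / (εs - ε)) c₂ ε) kx ky
        = γ - 4 * fsT5 Δ tpd (tpp + tsp ^ 2 / (εs - ε)) (c + tsp ^ 2 / (εs - ε)) c₂ ε
            - 4 * fsTp5 tpd (tpp + tsp ^ 2 / (εs - ε)) (c + tsp ^ 2 / (εs - ε)) c₂ ε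
            - 4 * fsTpp5 tpd (c + tsp ^ 2 / (εs - ε)) c₂ ε + cA Δ ε := by
  rw [det_fourBand6_eq_zero_iff_charPoly6 Δ εs tpd tpp c c₂ 0 tsp _ _ ε hε, oneBand_eq_oneBandXY]
  exact charPoly6_tdd_zero_eq_zero_iff_oneBandXY _ _ _ _ _ _ _ _ _

/-- THE CONTOUR THEOREM FOR THE FOUR-ORBITAL + `t_dd` MODEL (`c₂ = 0`, `ε ≠ ε_s`): every constant-energy contour is
EXACTLY the four-harmonic contour `oneBand5 ddT ddT1 ddT2 ddT3 0 = ddK` of `EmeryFermiSurfaceHarmonics` §4 at the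
co-shifted `(t_pp + a, t_pp′ + a)` with the SAME `t_dd`. [cite: AndersenEtAl1995, §6] -/
theorem det_fourBand6_c2_zero_eq_zero_iff_oneBand5 (Δ εs tpd tpp c d tsp kx ky ε : ℝ) (hε : ε ≠ εs) :
    (fourBand6 Δ εs tpd tpp c 0 d tsp (Real.sin (kx / 2)) (Real.sin (ky / 2))
        - ε • (1 : Matrix (Fin 4) (Fin 4) ℝ)).det = 0 ↔
      oneBand5 (ddT Δ tpd (tpp + tsp ^ 2 / (εs - ε)) (c + tsp ^ 2 / (εs - ε)) d ε)
          (ddT1 Δ tpd (tpp + tsp ^ 2 / (εs - ε)) (c + tsp ^ 2 / (εs - ε)) d ε)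
          (ddT2 Δ (tpp + tsp ^ 2 / (εs - ε)) (c + tsp ^ 2 / (εs - ε)) d ε)
          (ddT3 (tpp + tsp ^ 2 / (εs - ε)) (c + tsp ^ 2 / (εs - ε)) d) 0 kx ky
        = ddK Δ tpd (tpp + tsp ^ 2 / (εs - ε)) (c + tsp ^ 2 / (εs - ε)) d ε := by
  rw [det_fourBand6_eq_zero_iff_charPoly6 Δ εs tpd tpp c 0 d tsp _ _ ε hε, charPoly6_c2_zero_cos]
  constructor <;> intro h <;> linarith

/-- The `(2,1)` harmonic at the co-shifted point: `ddT3(t_pp + a, t_pp′ + a) = d(t_pp − t_pp′)(t_pp + t_pp′ + 2a)` —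
the axial channel RESCALES the `t‴` that `t_dd` generates, and cannot create it when `d = 0`. [folklore] -/
theorem ddT3_coshift (tpp c d a : ℝ) :
    ddT3 (tpp + a) (c + a) d = d * (tpp - c) * (tpp + c + 2 * a) := by
  unfold ddT3
  ring

end Summit.Ventures.CertifiedManyBodySolver.Downfold.Emery
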